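import Summits.MatrixMultiplication.MatrixMultiplication.Theorems.FarEdgeDescentCommutantObstruction
import Summits.MatrixMultiplication.MatrixMultiplication.Theorems.FarEdgeDescentTwistedStarCore
import HarnessLib

/-!
# Far-edge descent — converse rigidity, core: routed stars and their slice commutants

Support file for route `FarEdgeDescent` (aside `SubLogRate`), kernel IV of the lineage
`decomp-mm-lens-2` («structural dichotomy, special vs generic»).  Kernel II
(`FarEdgeDescentTwistedStarRigidity`) proved `𝔖_n(L)^{⊠N} ⋭ ⟨n,n,2L⟩^{⊠N}`; this file and
`FarEdgeDescentConverseRigidity` prove the CONVERSE `⟨n,n,2L⟩^{⊠N} ⋭ 𝔖_n(L)^{⊠N}`, so that the two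
quantum twins (Kernel III) are degeneration-INCOMPARABLE at every finite level.

The invariant is the commutant of the slice pencil (`FarEdgeDescentCommutantObstruction`).  To run
it we put both tensors in common *leaf coordinates* `σ = Fin n × (Fin L ⊕ Fin L)` (row of the
leaf variable, column with its leaf tag) and observe that both are **routed stars**
`routed p c (x, b, y) = [x.1 = p x.2 b ∧ c x.2 b = y.1 ∧ x.2 = y.2]`: the coherent star routes
every leaf through `(row, column)` of `X`, the twisted star routes the second leaf through
`(column, row)`.  For a routed star the two one-sided actions of a slice of the `N`-th Kronecker
power on a matrix are explicit (`mul_slicePow_apply`, `slicePow_mul_apply`), which gives: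
* every pair `(β, γ)` in the commutant of a routed-star power has `β = γ` (`commutant_fst_eq_snd`);
* for the twisted star, `β(u,z)` vanishes unless `u`, `z` have the same rows AND the same leaf
  tags position by position, and then only depends on the tags and columns (`twisted_entry`) —
  so the commutant has dimension `≤ 2^N L^{2N}`;
* for the coherent star the `(2L)^{2N}` "unit" matrices `unitMat r` commute with every slice and
  are linearly independent.

[cite: BurgisserClausenShokrollahi1997, (15.19)–(15.25); Strassen1988, §3]
-/

noncomputable section

open scoped BigOperators

set_option linter.dupNamespace false

namespace Summit.MatrixMultiplication.MatrixMultiplication.Theorems.FarEdgeDescentConverseRigidity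

open Literature.Computability.AlgebraicComplexity
open Summit.MatrixMultiplication.MatrixMultiplication.Theorems.FarEdgeDescentCommutantObstruction
open Summit.MatrixMultiplication.MatrixMultiplication.Theorems.FarEdgeDescentTwistedStar

/-! ## Routed stars and the one-sided slice actions of their powers -/

section Routed

variable {R : Type*} [CommSemiring R] {α γ : Type*} [DecidableEq α] [DecidableEq γ]

/-- The **routed star** with row router `p` and column router `c`: entry `1` at `(x, b, y)` iff
`x.1 = p x.2 b`, `c x.2 b = y.1` and `x.2 = y.2` (same leaf column, with tag). [folklore] -/
def routed (p c : γ → α × α → α) : α × γ → α × α → α × γ → R :=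
  fun x b y => if x.1 = p x.2 b ∧ c x.2 b = y.1 ∧ x.2 = y.2 then 1 else 0

/-- Column form of a routed star: for fixed `(b, y)` the only row index carrying a nonzero entry is
`(p y.2 b, y.2)`. [folklore] -/
theorem routed_col (p c : γ → α × α → α) (x : α × γ) (b : α × α) (y : α × γ) :
    routed (R := R) p c x b y = if x = (p y.2 b, y.2) ∧ c y.2 b = y.1 then 1 else 0 := by
  obtain ⟨x₁, x₂⟩ := x
  obtain ⟨y₁, y₂⟩ := y
  by_cases h : x₂ = y₂
  · subst h
    simp only [routed, Prod.mk.injEq, and_true]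
  · simp [routed, h]

/-- Row form of a routed star: for fixed `(x, b)` the only column index carrying a nonzero entry is
`(c x.2 b, x.2)`. [folklore] -/
theorem routed_row (p c : γ → α × α → α) (x : α × γ) (b : α × α) (y : α × γ) :
    routed (R := R) p c x b y = if (c x.2 b, x.2) = y ∧ x.1 = p x.2 b then 1 else 0 := by
  obtain ⟨x₁, x₂⟩ := x
  obtain ⟨y₁, y₂⟩ := y
  by_cases h : x₂ = y₂
  · subst h
    simp only [routed, Prod.mk.injEq, and_true]
    by_cases h₁ : x₁ = p x₂ b <;> by_cases h₂ : c x₂ b = y₁ <;> simp [h₁, h₂]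
  · simp [routed, h]

variable [Fintype α] [Fintype γ] {N : ℕ}

/-- Right action of a slice of the `N`-th power of a routed star on a row vector. [folklore] -/
theorem sum_mul_prod_routed (p c : γ → α × α → α) (ψ : (Fin N → α × γ) → R)
    (b : Fin N → α × α) (w : Fin N → α × γ) :
    ∑ z : Fin N → α × γ, ψ z * ∏ i, routed (R := R) p c (z i) (b i) (w i) =
      if ∀ i, c (w i).2 (b i) = (w i).1 then ψ (fun i => (p (w i).2 (b i), (w i).2)) else 0 := by
  have hprod : ∀ z : Fin N → α × γ, (∏ i, routed (R := R) p c (z i) (b i) (w i)) =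
      if z = fun i => (p (w i).2 (b i), (w i).2) then
        (if ∀ i, c (w i).2 (b i) = (w i).1 then 1 else 0) else 0 := by
    intro z
    by_cases h₁ : z = fun i => (p (w i).2 (b i), (w i).2)
    · subst h₁
      rw [if_pos rfl]
      by_cases h₂ : ∀ i, c (w i).2 (b i) = (w i).1
      · rw [if_pos h₂]
        exact Finset.prod_eq_one fun i _ => by rw [routed_col, if_pos ⟨rfl, h₂ i⟩]
      · rw [if_neg h₂]
        obtain ⟨i, hi⟩ := not_forall.mp h₂
        exact Finset.prod_eq_zero (Finset.mem_univ i) (by rw [routed_col, if_neg fun h' => hi h'.2])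
    · rw [if_neg h₁]
      obtain ⟨i, hi⟩ : ∃ i, z i ≠ (p (w i).2 (b i), (w i).2) :=
        not_forall.mp fun hall => h₁ (funext hall)
      exact Finset.prod_eq_zero (Finset.mem_univ i) (by rw [routed_col, if_neg fun h' => hi h'.1])
  simp only [hprod, mul_ite, mul_one, mul_zero, Finset.sum_ite_eq', Finset.mem_univ, if_true]

/-- Left action of a slice of the `N`-th power of a routed star on a column vector. [folklore] -/
theorem sum_prod_routed_mul (p c : γ → α × α → α) (ψ : (Fin N → α × γ) → R)
    (b : Fin N → α × α) (u : Fin N → α × γ) :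
    ∑ z : Fin N → α × γ, (∏ i, routed (R := R) p c (u i) (b i) (z i)) * ψ z =
      if ∀ i, (u i).1 = p (u i).2 (b i) then ψ (fun i => (c (u i).2 (b i), (u i).2)) else 0 := by
  have hprod : ∀ z : Fin N → α × γ, (∏ i, routed (R := R) p c (u i) (b i) (z i)) =
      if (fun i => (c (u i).2 (b i), (u i).2)) = z then
        (if ∀ i, (u i).1 = p (u i).2 (b i) then 1 else 0) else 0 := by
    intro z
    by_cases h₁ : (fun i => (c (u i).2 (b i), (u i).2)) = z
    · subst h₁
      rw [if_pos rfl]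
      by_cases h₂ : ∀ i, (u i).1 = p (u i).2 (b i)
      · rw [if_pos h₂]
        exact Finset.prod_eq_one fun i _ => by rw [routed_row, if_pos ⟨rfl, h₂ i⟩]
      · rw [if_neg h₂]
        obtain ⟨i, hi⟩ := not_forall.mp h₂
        exact Finset.prod_eq_zero (Finset.mem_univ i) (by rw [routed_row, if_neg fun h' => hi h'.2])
    · rw [if_neg h₁]
      obtain ⟨i, hi⟩ : ∃ i, (c (u i).2 (b i), (u i).2) ≠ z i :=
        not_forall.mp fun hall => h₁ (funext hall)
      exact Finset.prod_eq_zero (Finset.mem_univ i) (by rw [routed_row, if_neg fun h' => hi h'.1])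
  simp only [hprod, ite_mul, one_mul, zero_mul, Finset.sum_ite_eq, Finset.mem_univ, if_true]

/-- Entries of `φ · T_b` for a slice `T_b` of a routed-star power. [folklore] -/
theorem mul_slicePow_apply (p c : γ → α × α → α)
    (φ : Matrix (Fin N → α × γ) (Fin N → α × γ) R) (b : Fin N → α × α) (u w : Fin N → α × γ) :
    (φ * slice (kroneckerPow (routed (R := R) p c) N) b) u w =
      if ∀ i, c (w i).2 (b i) = (w i).1 then φ u (fun i => (p (w i).2 (b i), (w i).2)) else 0 := by
  simp only [Matrix.mul_apply, slice_apply, kroneckerPow_apply]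
  exact sum_mul_prod_routed p c (fun z => φ u z) b w

/-- Entries of `T_b · φ` for a slice `T_b` of a routed-star power. [folklore] -/
theorem slicePow_mul_apply (p c : γ → α × α → α)
    (φ : Matrix (Fin N → α × γ) (Fin N → α × γ) R) (b : Fin N → α × α) (u w : Fin N → α × γ) :
    (slice (kroneckerPow (routed (R := R) p c) N) b * φ) u w =
      if ∀ i, (u i).1 = p (u i).2 (b i) then φ (fun i => (c (u i).2 (b i), (u i).2)) w else 0 := by
  simp only [Matrix.mul_apply, slice_apply, kroneckerPow_apply]
  exact sum_prod_routed_mul p c (fun z => φ z w) b u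

/-- **Diagonal rigidity of the commutant.**  If both routers fix diagonal `X`-indices
(`p s (a,a) = a = c s (a,a)`, i.e. the slice at `X = 1` is the identity map in every factor),
then every pair `(β, γ)` with `β T_b = T_b γ` for all slices `T_b` of the power has `β = γ`. [folklore] -/
theorem commutant_fst_eq_snd (p c : γ → α × α → α) (hp : ∀ s a, p s (a, a) = a)
    (hc : ∀ s a, c s (a, a) = a) (β γ' : Matrix (Fin N → α × γ) (Fin N → α × γ) R)
    (h : ∀ b, β * slice (kroneckerPow (routed (R := R) p c) N) b =
      slice (kroneckerPow (routed (R := R) p c) N) b * γ') :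
    β = γ' := by
  refine Matrix.ext fun u w => ?_
  have e₁ := congr_fun (congr_fun (h fun i => ((w i).1, (w i).1)) u) w
  have e₂ := congr_fun (congr_fun (h fun i => ((u i).1, (u i).1)) u) w
  rw [mul_slicePow_apply, slicePow_mul_apply] at e₁ e₂
  simp only [hp, hc, Prod.mk.eta, implies_true, if_true] at e₁ e₂
  by_cases hrow : ∀ i, (u i).1 = (w i).1
  · rw [if_pos hrow] at e₁
    have hu : (fun i => ((w i).1, (u i).2)) = u := funext fun i => Prod.ext (hrow i).symm rfl
    rw [hu] at e₁
    exact e₁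
  · rw [if_neg hrow] at e₁ e₂
    exact e₁.trans e₂

end Routed

/-! ## Leaf coordinates for `⟨n,n,2L⟩` and `𝔖_n(L)` -/

section Leaf

variable (K : Type*) [Field K]

/-- `⟨n,n,2L⟩` in leaf coordinates `σ = Fin n × (Fin L ⊕ Fin L)` (columns `Fin (L+L) ≃ Fin L ⊕ Fin L`
via `finSumFinEquiv`). [folklore] -/
def cohLeaf (n L : ℕ) (u : Fin n × (Fin L ⊕ Fin L)) (b : Fin n × Fin n)
    (w : Fin n × (Fin L ⊕ Fin L)) : K :=
  matMulTensor K n n (L + L) (u.1, finSumFinEquiv u.2) b (w.1, finSumFinEquiv w.2)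

/-- `𝔖_n(L)` in leaf coordinates (`σ ≃ (Fin n × Fin L) ⊕ (Fin n × Fin L)` via
`Equiv.prodSumDistrib`). [folklore] -/
def twiLeaf (n L : ℕ) (u : Fin n × (Fin L ⊕ Fin L)) (b : Fin n × Fin n)
    (w : Fin n × (Fin L ⊕ Fin L)) : K :=
  twistedStar K n L (Equiv.prodSumDistrib _ _ _ u) b (Equiv.prodSumDistrib _ _ _ w)

variable {K}

/-- Row router of the twisted star: leaf `inl` reads the row of `X`, leaf `inr` its column. [folklore] -/
def pick {n L : ℕ} (s : Fin L ⊕ Fin L) (b : Fin n × Fin n) : Fin n :=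
  Sum.elim (fun _ => b.1) (fun _ => b.2) s

/-- Column router of the twisted star: leaf `inl` reads the column of `X`, leaf `inr` its row. [folklore] -/
def copick {n L : ℕ} (s : Fin L ⊕ Fin L) (b : Fin n × Fin n) : Fin n :=
  Sum.elim (fun _ => b.2) (fun _ => b.1) s

/-- `⟨n,n,2L⟩` is the routed star with routers `(row, column)` for both leaves. [folklore] -/
theorem cohLeaf_eq_routed (n L : ℕ) :
    cohLeaf K n L = routed (fun _ b => b.1) (fun _ b => b.2) := by
  funext u b w
  simp [cohLeaf, routed, matMulTensor]

/-- `𝔖_n(L)` is the routed star with routers `pick`, `copick`. [folklore] -/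
theorem twiLeaf_eq_routed (n L : ℕ) : twiLeaf K n L = routed pick copick := by
  funext u b w
  obtain ⟨r, s⟩ := u
  obtain ⟨r', s'⟩ := w
  rcases s with l | l <;> rcases s' with l' | l' <;>
    simp [twiLeaf, routed, pick, copick, twistedStar, matMulTensor]

/-- The change to leaf coordinates is a relabelling: a degeneration
`⟨n,n,2L⟩^{⊠N} ⊵ 𝔖_n(L)^{⊠N}` is a degeneration `cohLeaf^{⊠N} ⊵ twiLeaf^{⊠N}`. [cite: BurgisserClausenShokrollahi1997, (15.20)] -/
theorem algDegeneratesTo_leaf {n L N : ℕ}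
    (h : AlgDegeneratesTo (kroneckerPow (matMulTensor K n n (L + L)) N)
      (kroneckerPow (twistedStar K n L) N)) :
    AlgDegeneratesTo (kroneckerPow (cohLeaf K n L) N) (kroneckerPow (twiLeaf K n L) N) := by
  obtain ⟨h, A, B, C, hd⟩ := h
  have h₁ := hd.source_equiv
    (Equiv.piCongrRight fun _ : Fin N => (Equiv.refl (Fin n)).prodCongr
      (finSumFinEquiv : Fin L ⊕ Fin L ≃ Fin (L + L)))
    (Equiv.refl (Fin N → Fin n × Fin n))
    (Equiv.piCongrRight fun _ : Fin N => (Equiv.refl (Fin n)).prodCongr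
      (finSumFinEquiv : Fin L ⊕ Fin L ≃ Fin (L + L)))
  have h₂ := h₁.precomp
    (fun x : Fin N → Fin n × (Fin L ⊕ Fin L) => fun i => Equiv.prodSumDistrib _ _ _ (x i)) id
    (fun z : Fin N → Fin n × (Fin L ⊕ Fin L) => fun i => Equiv.prodSumDistrib _ _ _ (z i))
  exact ⟨h, _, _, _, h₂⟩

end Leaf

/-! ## The commutant of a twisted-star power is small -/

section Twisted

variable {K : Type*} [Field K] {n L N : ℕ}

/-- The test `X`-index: for a target entry with leaf tag `s` and row `a`, the index `b` with
`pick s b = a` and free coordinate `q`. [folklore] -/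
def mkb (s : Fin L ⊕ Fin L) (a q : Fin n) : Fin n × Fin n :=
  Sum.elim (fun _ => (a, q)) (fun _ => (q, a)) s

/-- The test index routes its own tag's row to `a`. [folklore] -/
theorem pick_mkb_self (s : Fin L ⊕ Fin L) (a q : Fin n) : pick s (mkb s a q) = a := by
  cases s <;> rfl

/-- The test index routes its own tag's column to the free coordinate `q`. [folklore] -/
theorem copick_mkb_self (s : Fin L ⊕ Fin L) (a q : Fin n) : copick s (mkb s a q) = q := by
  cases s <;> rfl

/-- A tag of the same side reads the row `a` off the test index. [folklore] -/
theorem pick_mkb {s s' : Fin L ⊕ Fin L} (h : s'.isLeft = s.isLeft) (a q : Fin n) :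
    pick s' (mkb s a q) = a := by
  cases s <;> cases s' <;> simp_all [pick, mkb]

/-- A tag of the same side reads the column `q` off the test index. [folklore] -/
theorem copick_mkb {s s' : Fin L ⊕ Fin L} (h : s'.isLeft = s.isLeft) (a q : Fin n) :
    copick s' (mkb s a q) = q := by
  cases s <;> cases s' <;> simp_all [copick, mkb]

/-- A tag of the OTHER side reads the free coordinate `q` as its row: the twist. [folklore] -/
theorem pick_mkb_ne {s s' : Fin L ⊕ Fin L} (h : s'.isLeft ≠ s.isLeft) (a q : Fin n) :
    pick s' (mkb s a q) = q := by
  cases s <;> cases s' <;> simp_all [pick, mkb]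

/-- A row index different from `a` (needs `2 ≤ n`). [folklore] -/
def other (hn : 2 ≤ n) (a : Fin n) : Fin n := if (a : ℕ) = 0 then ⟨1, hn⟩ else ⟨0, by omega⟩

/-- `other hn a ≠ a`. [folklore] -/
theorem other_ne (hn : 2 ≤ n) (a : Fin n) : other hn a ≠ a := by
  unfold other
  split_ifs with h
  · intro e; have := congrArg Fin.val e; simp only at this; omega
  · intro e; have := congrArg Fin.val e; simp only at this; omega

/-- The base point of a leaf index: all rows moved to `0`, columns and tags kept. [folklore] -/
def base (hn : 2 ≤ n) (u : Fin N → Fin n × (Fin L ⊕ Fin L)) : Fin N → Fin n × (Fin L ⊕ Fin L) :=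
  fun i => (⟨0, by omega⟩, (u i).2)

/-- **Entries of the commutant of `𝔖_n(L)^{⊠N}`.**  If `φ` commutes with every slice then
`φ(u,z) = 0` unless `u` and `z` have the same row and the same leaf tag in every position, and in
that case `φ(u,z) = φ(base u, base z)`.  One instance of the commutation relation per entry. [folklore] -/
theorem twisted_entry (hn : 2 ≤ n)
    (φ : Matrix (Fin N → Fin n × (Fin L ⊕ Fin L)) (Fin N → Fin n × (Fin L ⊕ Fin L)) K)
    (hφ : ∀ b, φ * slice (kroneckerPow (routed (R := K) pick copick) N) b =
      slice (kroneckerPow (routed (R := K) pick copick) N) b * φ)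
    (u z : Fin N → Fin n × (Fin L ⊕ Fin L)) :
    φ u z = if ∀ i, (u i).1 = (z i).1 ∧ (u i).2.isLeft = (z i).2.isLeft
      then φ (base hn u) (base hn z) else 0 := by
  -- free coordinate: `0` where the tags match, a row `≠ (u i).1` where they do not
  set q : Fin N → Fin n := fun i =>
    if (u i).2.isLeft = (z i).2.isLeft then ⟨0, by omega⟩ else other hn (u i).1 with hq
  set b : Fin N → Fin n × Fin n := fun i => mkb (z i).2 (z i).1 (q i) with hb
  set w : Fin N → Fin n × (Fin L ⊕ Fin L) := fun i => (q i, (z i).2) with hw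
  have key := congr_fun (congr_fun (hφ b) u) w
  rw [mul_slicePow_apply, slicePow_mul_apply] at key
  have hc : ∀ i, copick (w i).2 (b i) = (w i).1 := fun i => by
    simp only [hw, hb, copick_mkb_self]
  have hz : (fun i => (pick (w i).2 (b i), (w i).2)) = z := funext fun i => by
    simp only [hw, hb, pick_mkb_self, Prod.mk.eta]
  rw [if_pos hc, hz] at key
  rw [key]
  by_cases hM : ∀ i, (u i).1 = (z i).1 ∧ (u i).2.isLeft = (z i).2.isLeft
  · have hcond : ∀ i, (u i).1 = pick (u i).2 (b i) := fun i => by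
      rw [hb]; simp only; rw [pick_mkb (hM i).2]; exact (hM i).1
    rw [if_pos hM, if_pos hcond]
    have hq0 : ∀ i, q i = ⟨0, by omega⟩ := fun i => by
      simp only [hq]
      exact if_pos (hM i).2
    congr 1
    · funext i
      simp only [hb, copick_mkb (hM i).2, hq0 i, base]
    · funext i
      simp only [hw, hq0 i, base]
  · have hcond : ¬ ∀ i, (u i).1 = pick (u i).2 (b i) := by
      intro h'
      apply hM
      intro i
      by_cases ht : (u i).2.isLeft = (z i).2.isLeft
      · refine ⟨?_, ht⟩
        have := h' i
        rw [hb] at this; simp only at this; rwa [pick_mkb ht] at this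
      · exfalso
        have := h' i
        rw [hb] at this; simp only at this
        rw [pick_mkb_ne ht, hq] at this; simp only [ht, if_false] at this
        exact other_ne hn (u i).1 this.symm
    rw [if_neg hM, if_neg hcond]

/-- Leaf tag and column of a leaf index, and the reassembly. [folklore] -/
def strip (s : Fin L ⊕ Fin L) : Fin L := Sum.elim id id s

/-- Reassemble a column with tag from a Boolean tag and a column. [folklore] -/
def mkCol (t : Bool) (l : Fin L) : Fin L ⊕ Fin L := if t then Sum.inl l else Sum.inr l

/-- Reassembling tag and column gives back the tagged column. [folklore] -/
theorem mkCol_strip (s : Fin L ⊕ Fin L) : mkCol s.isLeft (strip s) = s := by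
  cases s <;> simp [mkCol, strip]

/-- The parametrisation of the commutant of `𝔖_n(L)^{⊠N}`: a function of (tag pattern, columns,
columns) placed on the pairs with equal rows and equal tags. [folklore] -/
def paramMap :
    (((Fin N → Bool) × (Fin N → Fin L) × (Fin N → Fin L)) → K) →ₗ[K]
      Matrix (Fin N → Fin n × (Fin L ⊕ Fin L)) (Fin N → Fin n × (Fin L ⊕ Fin L)) K where
  toFun g := Matrix.of fun u z =>
    if ∀ i, (u i).1 = (z i).1 ∧ (u i).2.isLeft = (z i).2.isLeft then
      g (fun i => (u i).2.isLeft, fun i => strip (u i).2, fun i => strip (z i).2) else 0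
  map_add' g g' := by
    refine Matrix.ext fun u z => ?_
    simp only [Matrix.of_apply, Matrix.add_apply, Pi.add_apply]
    split_ifs <;> simp
  map_smul' a g := by
    refine Matrix.ext fun u z => ?_
    simp only [Matrix.of_apply, Matrix.smul_apply, Pi.smul_apply, smul_eq_mul, RingHom.id_apply]
    split_ifs <;> simp

/-- Entries of `paramMap g`. [folklore] -/
theorem paramMap_apply (g : ((Fin N → Bool) × (Fin N → Fin L) × (Fin N → Fin L)) → K)
    (u z : Fin N → Fin n × (Fin L ⊕ Fin L)) :
    paramMap (K := K) (n := n) g u z =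
      if ∀ i, (u i).1 = (z i).1 ∧ (u i).2.isLeft = (z i).2.isLeft then
        g (fun i => (u i).2.isLeft, fun i => strip (u i).2, fun i => strip (z i).2) else 0 := rfl

/-- **Every matrix in the commutant of `𝔖_n(L)^{⊠N}` is in the image of `paramMap`.** [folklore] -/
theorem twisted_mem_range (hn : 2 ≤ n)
    (φ : Matrix (Fin N → Fin n × (Fin L ⊕ Fin L)) (Fin N → Fin n × (Fin L ⊕ Fin L)) K)
    (hφ : ∀ b, φ * slice (kroneckerPow (routed (R := K) pick copick) N) b =
      slice (kroneckerPow (routed (R := K) pick copick) N) b * φ) :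
    φ ∈ LinearMap.range (paramMap (K := K) (n := n) (L := L) (N := N)) := by
  refine ⟨fun k => φ (fun i => (⟨0, by omega⟩, mkCol (k.1 i) (k.2.1 i)))
    (fun i => (⟨0, by omega⟩, mkCol (k.1 i) (k.2.2 i))), ?_⟩
  refine Matrix.ext fun u z => ?_
  rw [paramMap_apply, twisted_entry hn φ hφ u z]
  by_cases hM : ∀ i, (u i).1 = (z i).1 ∧ (u i).2.isLeft = (z i).2.isLeft
  · rw [if_pos hM, if_pos hM]
    dsimp only
    congr 1
    · funext i; simp only [base, mkCol_strip]
    · funext i; simp only [base, (hM i).2, mkCol_strip]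
  · rw [if_neg hM, if_neg hM]

end Twisted

end Summit.MatrixMultiplication.MatrixMultiplication.Theorems.FarEdgeDescentConverseRigidity

end
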